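import Mathlib
import HarnessLib
import Summits.Ventures.LatticeQCDFlow.Exactness.MarsagliaTsangSqueeze
import Summits.Ventures.LatticeQCDFlow.Exactness.BetaFromGammas
import Summits.Ventures.LatticeQCDFlow.Exactness.KennedyPendletonSampler

/-!
# The Marsaglia–Tsang gamma generator is exact on the engine's range: from `N(0,1)` and `U(0,1)` to `Gamma(a, 1)`

HONEST FRAMING: exact (Metropolis-corrected) sampling algorithms for lattice gauge theory;
figures of merit are autocorrelation/cost numbers at stated couplings and volumes; no
continuum-physics claim.

Venture `LatticeQCDFlow` (cell pub-lqcd), topic `Exactness`, FANOUT row 9 (eng-latcore, the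
engine `latflow.core`).  NEW WORK of the cell over Mathlib (`gaussianReal`, `gammaMeasure`,
`lintegral_image_eq_lintegral_abs_deriv_mul`) and row 9's `RejectionSampling.lean` (the loop
outputs the normalised accepted part of one round), `MarsagliaTsangSqueeze.lean` (the squeeze is
dominated by the test), `BetaFromGammas.lean`, `KennedyPendletonSampler.lean` (`measurable_decide`).
Nothing is cited as a fact.  Printed counterpart, NAMED ONLY: Marsaglia–Tsang, ACM TOMS 26 (2000).

`csrc/cpn_kernel.c` `rng_gamma(a)` (`a ≥ 1`, `d = a − 1/3`, `c = 1/√(9d)`), in idealised real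
arithmetic with `N(0,1)` and `U(0,1)` as primitives:
INNER LOOP `do { x = gauss; v = 1 + c x } while (v ≤ 0)` — `mtGaussRound`, **`loopLaw_mtGaussRound`**:
it outputs `N(0,1)` conditioned on `1 + cx > 0` (`mtGauss`);
OUTER ROUND — `v ← v³`, `u ∼ U(0,1)`, ACCEPT iff `u < 1 − 0.0331x⁴` or
`log u < x²/2 + d(1 − v + log v)` (`mtAcc`), output `d·v` (`mtStep`, `mtRound`);
* `unitLaw_mtTest` — given `x` with `1 + cx > 0` the round accepts with probability EXACTLY
  `exp(d φ(cx))` (the squeeze never fires outside the test: `mt_squeeze`; `φ ≤ 0`);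
* `mt_pointwise` — Marsaglia–Tsang's identity: Gaussian density × acceptance probability, transported
  by `y = d(1+cx)³`, is a constant `mtK d` times `y^{a−1}e^{−y}`;
* **`accPart_mtRound`** — the accepted part of one round is `C • gammaMeasure (d + 1/3) 1`;
* **`loopLaw_mtRound`** — THE GENERATOR IS EXACT: for every `d ≥ 7/6` (shape `a = d + 1/3 ≥ 3/2`,
  every engine call `a = N − 1/2`, `N ≥ 2`) the loop outputs EXACTLY Mathlib's `gammaMeasure a 1`,
  and halts almost surely (`isProbabilityMeasure_loopLaw_mtRound`).

With `BetaFromGammas.lean` and `WoodSampler.lean`/`VMFSiteHeatBathGeneral.lean` this types the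
CP(N−1) site heat bath from the Gaussian and uniform primitives up.  NOT CLAIMED: shapes
`1 ≤ a < 3/2`; the boost `a < 1` (never called); floating point; the Gaussian generator itself
(Marsaglia polar / Box–Muller — separate file).
-/

namespace Summit.Ventures.LatticeQCDFlow.Exactness

open MeasureTheory Measure Set Real ProbabilityTheory
open scoped ENNReal

section MT

variable {d : ℝ}

/-! ## §1 The inner loop: a standard Gaussian conditioned on `1 + cx > 0` -/

/-- `σ = √(9d) = 1/c`. -/
noncomputable def mtSigma (d : ℝ) : ℝ := Real.sqrt (9 * d)

/-- `σ > 0` for `d > 0`. -/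
theorem mtSigma_pos (hd : 0 < d) : 0 < mtSigma d := Real.sqrt_pos.2 (by positivity)

/-- The halting set of the inner loop, `{x | 1 + cx > 0} = (−σ, ∞)`. -/
theorem setOf_mt_inner (hd : 0 < d) : {x : ℝ | 0 < 1 + x / mtSigma d} = Ioi (-mtSigma d) := by
  have hσ := mtSigma_pos hd
  ext x
  rw [mem_setOf_eq, mem_Ioi, ← mul_lt_mul_iff_of_pos_left hσ, mul_zero, mul_add, mul_one, mul_div_cancel₀ _ hσ.ne']
  constructor <;> intro h <;> linarith

/-- **The inner round**: draw `x ∼ N(0,1)`, accept iff `1 + cx > 0`. -/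
noncomputable def mtGaussRound (d : ℝ) : Measure (ℝ × Bool) :=
  (gaussianReal 0 1).map fun x => (x, decide (0 < 1 + x / mtSigma d))

/-- **Its output**: `N(0,1)` conditioned on `(−σ, ∞)`. -/
noncomputable def mtGauss (d : ℝ) : Measure ℝ :=
  ((gaussianReal 0 1) (Ioi (-mtSigma d)))⁻¹ • (gaussianReal 0 1).restrict (Ioi (-mtSigma d))

/-- The conditioning event has positive Gaussian probability … -/
theorem gaussianReal_Ioi_ne_zero (d : ℝ) : (gaussianReal 0 1) (Ioi (-mtSigma d)) ≠ 0 := fun h => by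
  have := gaussianReal_absolutelyContinuous' 0 one_ne_zero h
  simp at this

/-- … so `mtGauss d` is a probability measure. -/
instance isProbabilityMeasure_mtGauss (d : ℝ) : IsProbabilityMeasure (mtGauss d) :=
  ⟨by rw [mtGauss, Measure.smul_apply, smul_eq_mul, Measure.restrict_apply MeasurableSet.univ, univ_inter,
    ENNReal.inv_mul_cancel (gaussianReal_Ioi_ne_zero d) (measure_ne_top _ _)]⟩

/-- The inner round is a probability law. -/
instance isProbabilityMeasure_mtGaussRound (d : ℝ) : IsProbabilityMeasure (mtGaussRound d) :=
  isProbabilityMeasure_map ((measurable_id.prodMk (measurable_decide (measurableSet_lt measurable_const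
    (measurable_const.add (measurable_id.div_const _))))).aemeasurable)

/-- **THE INNER LOOP IS EXACT**: it outputs `N(0,1)` conditioned on `1 + cx > 0` (`d > 0`). -/
theorem loopLaw_mtGaussRound (hd : 0 < d) : loopLaw (mtGaussRound d) = mtGauss d := by
  have hmeas : Measurable fun x : ℝ => (x, decide (0 < 1 + x / mtSigma d)) :=
    measurable_id.prodMk (measurable_decide (measurableSet_lt measurable_const
      (measurable_const.add (measurable_id.div_const _))))
  have hpre : ∀ A : Set ℝ, (fun x : ℝ => (x, decide (0 < 1 + x / mtSigma d))) ⁻¹' (A ×ˢ {true}) =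
      A ∩ Ioi (-mtSigma d) := by
    intro A; ext x
    simp only [mem_preimage, mem_prod, mem_singleton_iff, decide_eq_true_eq, mem_inter_iff, ← setOf_mt_inner hd,
      mem_setOf_eq]
  have hacc : accPart (mtGaussRound d) = (gaussianReal 0 1).restrict (Ioi (-mtSigma d)) := by
    ext A hA
    rw [accPart_apply hA, mtGaussRound, Measure.map_apply hmeas (hA.prod (measurableSet_singleton _)), hpre,
      Measure.restrict_apply hA]
  rw [loopLaw_eq, hacc, mtGaussRound, Measure.map_apply hmeas (MeasurableSet.univ.prod (measurableSet_singleton _)),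
    hpre, univ_inter, mtGauss]

/-! ## §2 One outer round -/

/-- `v = (1 + cx)³`. -/
noncomputable def mtV (d x : ℝ) : ℝ := (1 + x / mtSigma d) ^ 3

/-- The engine's ACCEPT EVENT on pairs `(x, u)`: SQUEEZE `u < 1 − 0.0331x⁴` OR TEST
`log u < x²/2 + d(1 − v + log v)`. -/
abbrev mtAcc (d : ℝ) : Set (ℝ × ℝ) :=
  {p | p.2 < 1 - 0.0331 * p.1 ^ 4 ∨ Real.log p.2 < p.1 ^ 2 / 2 + d * (1 - mtV d p.1 + Real.log (mtV d p.1))}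

/-- **One outer round, as the engine runs it**: from `(x, u)` propose `d·v` and accept iff `(x, u) ∈ mtAcc d`. -/
noncomputable def mtStep (d : ℝ) (p : ℝ × ℝ) : ℝ × Bool :=
  (d * mtV d p.1, decide (p ∈ mtAcc d))

/-- Measurability of the accept event. -/
theorem measurableSet_mtAcc (d : ℝ) : MeasurableSet (mtAcc d) := by
  have h1 : Measurable fun p : ℝ × ℝ => 1 - 0.0331 * p.1 ^ 4 := by fun_prop
  have h2 : Measurable fun p : ℝ × ℝ => Real.log p.2 := Real.measurable_log.comp measurable_snd
  have h3 : Measurable fun p : ℝ × ℝ => p.1 ^ 2 / 2 + d * (1 - mtV d p.1 + Real.log (mtV d p.1)) := by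
    unfold mtV
    exact ((measurable_fst.pow_const 2).div_const 2).add (measurable_const.mul
      ((measurable_const.sub (by fun_prop)).add (Real.measurable_log.comp (by fun_prop))))
  exact (measurableSet_lt measurable_snd h1).union (measurableSet_lt h2 h3)

/-- `mtStep` is measurable. -/
theorem measurable_mtStep (d : ℝ) : Measurable (mtStep d) := by
  unfold mtStep
  exact Measurable.prodMk (by unfold mtV; fun_prop) (measurable_decide (measurableSet_mtAcc d))

/-- The law of one outer round on `ℝ × Bool`. -/
noncomputable def mtRound (d : ℝ) : Measure (ℝ × Bool) := ((mtGauss d).prod unitLaw).map (mtStep d)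

/-- One round is a probability law. -/
instance isProbabilityMeasure_mtRound (d : ℝ) : IsProbabilityMeasure (mtRound d) :=
  isProbabilityMeasure_map (measurable_mtStep d).aemeasurable

/-- `x⁴ = 81 d² (cx)⁴`. -/
theorem pow_four_eq (hd : 0 < d) (x : ℝ) : x ^ 4 = 81 * d ^ 2 * (x / mtSigma d) ^ 4 := by
  have hσ : mtSigma d ^ 2 = 9 * d := Real.sq_sqrt (by positivity)
  have hσ0 : mtSigma d ≠ 0 := (mtSigma_pos hd).ne'
  rw [div_pow, show (81 : ℝ) * d ^ 2 = (9 * d) ^ 2 by ring, ← hσ]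
  field_simp

/-- **The acceptance probability given `x`** (`1 + cx > 0`, `d ≥ 7/6`): the test on a uniform `u`
succeeds with probability EXACTLY `exp(d φ(cx))` — the squeeze never accepts outside the test. -/
theorem unitLaw_mtTest (hd : 7 / 6 ≤ d) {x : ℝ} (hx : 0 < 1 + x / mtSigma d) :
    unitLaw {u : ℝ | (x, u) ∈ mtAcc d} = ENNReal.ofReal (Real.exp (d * mtPhi (x / mtSigma d))) := by
  have hd0 : 0 < d := by linarith
  have ht : -1 < x / mtSigma d := by linarith
  have hexp : x ^ 2 / 2 + d * (1 - mtV d x + Real.log (mtV d x)) = d * mtPhi (x / mtSigma d) :=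
    mt_exponent_eq hd0 x
  have hsq : 1 - 0.0331 * x ^ 4 ≤ Real.exp (d * mtPhi (x / mtSigma d)) := by
    rw [pow_four_eq hd0]; exact mt_squeeze hd ht
  have hle1 : Real.exp (d * mtPhi (x / mtSigma d)) ≤ 1 :=
    Real.exp_le_one_iff.2 (mul_nonpos_of_nonneg_of_nonpos hd0.le (mtPhi_nonpos ht))
  have hset : {u : ℝ | (x, u) ∈ mtAcc d} ∩ Ioo 0 1 = Ioo 0 (Real.exp (d * mtPhi (x / mtSigma d))) := by
    ext u
    simp only [mtAcc, hexp, mem_inter_iff, mem_setOf_eq, mem_Ioo]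
    constructor
    · rintro ⟨h | h, hu0, hu1⟩
      · exact ⟨hu0, lt_of_lt_of_le h hsq⟩
      · exact ⟨hu0, by rwa [Real.log_lt_iff_lt_exp hu0] at h⟩
    · rintro ⟨hu0, hu⟩
      exact ⟨Or.inr ((Real.log_lt_iff_lt_exp hu0).2 hu), hu0, lt_of_lt_of_le hu hle1⟩
  have hm : MeasurableSet {u : ℝ | (x, u) ∈ mtAcc d} :=
    (measurable_const.prodMk measurable_id : Measurable fun u : ℝ => (x, u)) (measurableSet_mtAcc d)
  rw [unitLaw_apply hm, hset, Real.volume_Ioo, sub_zero]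

/-! ## §3 The substitution `y = d(1 + cx)³` and Marsaglia–Tsang's density identity -/

/-- `T(x) = d(1 + x/σ)³` maps `(−σ, ∞)` onto `(0, ∞)`. -/
theorem image_mtT (hd : 0 < d) : (fun x => d * mtV d x) '' Ioi (-mtSigma d) = Ioi 0 := by
  have hσ := mtSigma_pos hd
  ext y
  constructor
  · rintro ⟨x, hx, rfl⟩
    have hb : 0 < 1 + x / mtSigma d := by rw [← setOf_mt_inner hd] at hx; exact hx
    exact mul_pos hd (pow_pos hb 3)
  · intro hy
    have hy' : 0 < y / d := div_pos hy hd
    refine ⟨mtSigma d * ((y / d) ^ ((1 : ℝ) / 3) - 1), ?_, ?_⟩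
    · rw [← setOf_mt_inner hd, mem_setOf_eq, mul_div_cancel_left₀ _ hσ.ne']
      have := Real.rpow_pos_of_pos hy' ((1 : ℝ) / 3)
      linarith
    · simp only [mtV]
      rw [mul_div_cancel_left₀ _ hσ.ne', add_sub_cancel, ← Real.rpow_natCast,
        ← Real.rpow_mul hy'.le]
      norm_num
      rw [mul_div_cancel₀ _ hd.ne']

/-- `T` is injective on `(−σ, ∞)`. -/
theorem injOn_mtT (hd : 0 < d) : InjOn (fun x => d * mtV d x) (Ioi (-mtSigma d)) := by
  intro x hx y hy h
  have hbx : 0 < 1 + x / mtSigma d := by rw [← setOf_mt_inner hd] at hx; exact hx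
  have hby : 0 < 1 + y / mtSigma d := by rw [← setOf_mt_inner hd] at hy; exact hy
  have h3 : (1 + x / mtSigma d) ^ 3 = (1 + y / mtSigma d) ^ 3 := mul_left_cancel₀ hd.ne' h
  have h1 : 1 + x / mtSigma d = 1 + y / mtSigma d :=
    (pow_left_inj₀ hbx.le hby.le (by norm_num : (3 : ℕ) ≠ 0)).1 h3
  have := mtSigma_pos hd
  field_simp at h1
  linarith

/-- `T′(x) = 3d(1 + x/σ)²/σ`. -/
theorem hasDerivAt_mtT (d x : ℝ) :
    HasDerivAt (fun x => d * mtV d x) (d * (3 * (1 + x / mtSigma d) ^ 2 * (1 / mtSigma d))) x := by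
  unfold mtV
  have h : HasDerivAt (fun x : ℝ => 1 + x / mtSigma d) (1 / mtSigma d) x := by
    simpa using ((hasDerivAt_id' x).div_const (mtSigma d)).const_add 1
  simpa using (h.pow 3).const_mul d

/-- Marsaglia–Tsang's constant `K(d) = e^d σ / (3 d^{d+1/3} √(2π))`. -/
noncomputable def mtK (d : ℝ) : ℝ := Real.exp d * mtSigma d / (3 * d ^ (d + 1 / 3) * Real.sqrt (2 * π))

/-- `K(d) > 0` for `d > 0`. -/
theorem mtK_pos (hd : 0 < d) : 0 < mtK d := by
  unfold mtK
  have := mtSigma_pos hd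
  have := Real.rpow_pos_of_pos hd (d + 1 / 3)
  positivity

/-- **Marsaglia–Tsang's density identity** (`1 + cx > 0`): Gaussian density × acceptance probability
`=` `|T′(x)| · K(d) · T(x)^{a−1} e^{−T(x)}` with `a = d + 1/3`. -/
theorem mt_pointwise (hd : 0 < d) {x : ℝ} (hx : 0 < 1 + x / mtSigma d) :
    gaussianPDFReal 0 1 x * Real.exp (d * mtPhi (x / mtSigma d)) =
      d * (3 * (1 + x / mtSigma d) ^ 2 * (1 / mtSigma d)) *
        (mtK d * ((d * mtV d x) ^ (d + 1 / 3 - 1) * Real.exp (-(d * mtV d x)))) := by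
  set b := 1 + x / mtSigma d with hb
  have hσ := mtSigma_pos hd
  -- the exponent: `dφ(cx) = x²/2 + d(1 − b³ + 3 log b)`
  have hexp : d * mtPhi (x / mtSigma d) = x ^ 2 / 2 + d * (1 - b ^ 3 + Real.log (b ^ 3)) :=
    (mt_exponent_eq hd x).symm
  have hpdf : gaussianPDFReal 0 1 x = (Real.sqrt (2 * π))⁻¹ * Real.exp (-x ^ 2 / 2) := by
    simp [gaussianPDFReal]
  -- powers of `b`
  have hB3 : (0 : ℝ) < b ^ 3 := pow_pos hx 3
  have hlogB : Real.exp (d * Real.log (b ^ 3)) = b ^ (3 * d) := by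
    rw [Real.log_pow, Nat.cast_ofNat, show d * (3 * Real.log b) = Real.log b * (3 * d) by ring,
      ← Real.rpow_def_of_pos hx]
  have hBpow : (b ^ 3) ^ (d + 1 / 3 - 1) = b ^ (3 * d - 2) := by
    rw [← Real.rpow_natCast b 3, ← Real.rpow_mul hx.le]; congr 1; push_cast; ring
  have hB2 : b ^ 2 * b ^ (3 * d - 2) = b ^ (3 * d) := by
    rw [← Real.rpow_natCast b 2, ← Real.rpow_add hx]; congr 1; push_cast; ring
  have hD : d * d ^ (d + 1 / 3 - 1) = d ^ (d + 1 / 3) := by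
    conv_lhs => rw [show d * d ^ (d + 1 / 3 - 1) = d ^ (1 : ℝ) * d ^ (d + 1 / 3 - 1) by rw [Real.rpow_one]]
    rw [← Real.rpow_add hd]; congr 1; ring
  have hDpos : 0 < d ^ (d + 1 / 3) := Real.rpow_pos_of_pos hd _
  have hsq : 0 < Real.sqrt (2 * π) := by positivity
  -- left side
  have hL : gaussianPDFReal 0 1 x * Real.exp (d * mtPhi (x / mtSigma d)) =
      (Real.sqrt (2 * π))⁻¹ * (Real.exp d * Real.exp (-(d * b ^ 3)) * b ^ (3 * d)) := by
    rw [hpdf, hexp, mul_assoc, ← Real.exp_add, ← hlogB, ← Real.exp_add, ← Real.exp_add]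
    congr 2; ring
  -- right side
  have hR : d * (3 * b ^ 2 * (1 / mtSigma d)) * (mtK d * ((d * mtV d x) ^ (d + 1 / 3 - 1) * Real.exp (-(d * mtV d x)))) =
      (Real.sqrt (2 * π))⁻¹ * (Real.exp d * Real.exp (-(d * b ^ 3)) * b ^ (3 * d)) := by
    simp only [mtV, ← hb]
    rw [Real.mul_rpow hd.le hB3.le, hBpow, mtK, ← hB2, ← hD]
    field_simp
  rw [hL, hR]

/-! ## §4 The accepted part of one round and the loop law -/

/-- The normalising constant of the accepted part. -/
noncomputable def mtAccConst (d : ℝ) : ℝ≥0∞ :=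
  ((gaussianReal 0 1) (Ioi (-mtSigma d)))⁻¹ * ENNReal.ofReal (mtK d * Real.Gamma (d + 1 / 3))

/-- It is neither zero … -/
theorem mtAccConst_ne_zero (hd : 0 < d) : mtAccConst d ≠ 0 :=
  mul_ne_zero (ENNReal.inv_ne_zero.2 (measure_ne_top _ _))
    (by rw [Ne, ENNReal.ofReal_eq_zero, not_le]; exact mul_pos (mtK_pos hd) (Real.Gamma_pos_of_pos (by linarith)))

/-- … nor infinite. -/
theorem mtAccConst_ne_top (d : ℝ) : mtAccConst d ≠ ∞ :=
  ENNReal.mul_ne_top (ENNReal.inv_ne_top.2 (gaussianReal_Ioi_ne_zero d)) ENNReal.ofReal_ne_top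

/-- Integrating against `N(0,1)` on `(−σ, ∞)` is integrating against its density there. -/
theorem setLIntegral_gaussianReal_Ioi (a : ℝ) {F : ℝ → ℝ≥0∞} (hF : Measurable F) :
    ∫⁻ x in Ioi a, F x ∂(gaussianReal 0 1) = ∫⁻ x in Ioi a, ENNReal.ofReal (gaussianPDFReal 0 1 x) * F x := by
  have hf : Measurable (gaussianPDF 0 1) := (measurable_gaussianPDFReal 0 1).ennreal_ofReal
  rw [gaussianReal_of_var_ne_zero 0 one_ne_zero, restrict_withDensity measurableSet_Ioi,
    lintegral_withDensity_eq_lintegral_mul _ hf hF]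
  rfl

/-- **The accepted part of one Marsaglia–Tsang round**: for measurable `A` and `d ≥ 7/6`,
`P(d·v ∈ A, accept) = C · Gamma(d + 1/3, 1)(A)`. -/
theorem mtRound_apply_prod_true (hd : 7 / 6 ≤ d) {A : Set ℝ} (hA : MeasurableSet A) :
    mtRound d (A ×ˢ {true}) = mtAccConst d * gammaMeasure (d + 1 / 3) 1 A := by
  have hd0 : 0 < d := by linarith
  have hσ := mtSigma_pos hd0
  have hT : Measurable fun x : ℝ => d * mtV d x := by unfold mtV; fun_prop
  have hS : MeasurableSet {p : ℝ × ℝ | d * mtV d p.1 ∈ A ∧ p ∈ mtAcc d} :=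
    (hA.preimage (hT.comp measurable_fst)).inter (measurableSet_mtAcc d)
  have hpre : mtStep d ⁻¹' (A ×ˢ {true}) = {p : ℝ × ℝ | d * mtV d p.1 ∈ A ∧ p ∈ mtAcc d} := by
    ext p; simp [mtStep]
  rw [mtRound, Measure.map_apply (measurable_mtStep d) (hA.prod (measurableSet_singleton _)), hpre,
    Measure.prod_apply hS]
  -- the `u`-slices, for `x` in the halting set of the inner loop
  have hslice : ∀ x ∈ Ioi (-mtSigma d), unitLaw (Prod.mk x ⁻¹' {p : ℝ × ℝ | d * mtV d p.1 ∈ A ∧ p ∈ mtAcc d}) =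
      A.indicator (fun _ => ENNReal.ofReal (Real.exp (d * mtPhi (x / mtSigma d)))) (d * mtV d x) := by
    intro x hx
    have hx' : 0 < 1 + x / mtSigma d := by rw [← setOf_mt_inner hd0] at hx; exact hx
    by_cases hxA : d * mtV d x ∈ A
    · have : Prod.mk x ⁻¹' {p : ℝ × ℝ | d * mtV d p.1 ∈ A ∧ p ∈ mtAcc d} = {u | (x, u) ∈ mtAcc d} := by
        ext u; simp only [mem_preimage, mem_setOf_eq]; exact ⟨fun h => h.2, fun h => ⟨hxA, h⟩⟩
      rw [this, indicator_of_mem hxA, unitLaw_mtTest hd hx']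
    · have : Prod.mk x ⁻¹' {p : ℝ × ℝ | d * mtV d p.1 ∈ A ∧ p ∈ mtAcc d} = ∅ := by
        ext u; simp only [mem_preimage, mem_setOf_eq, mem_empty_iff_false, iff_false, not_and]
        exact fun h => absurd h hxA
      rw [this, indicator_of_notMem hxA, measure_empty]
  -- integrate against `mtGauss d = (γ S)⁻¹ • γ|_S`, `γ = N(0,1) = density × Lebesgue`
  have hW : Measurable fun x : ℝ =>
      A.indicator (fun _ => ENNReal.ofReal (Real.exp (d * mtPhi (x / mtSigma d)))) (d * mtV d x) := by
    have hc : Measurable fun x : ℝ => ENNReal.ofReal (Real.exp (d * mtPhi (x / mtSigma d))) := by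
      unfold mtPhi; fun_prop
    have h : Measurable (((fun x : ℝ => d * mtV d x) ⁻¹' A).indicator
        fun x : ℝ => ENNReal.ofReal (Real.exp (d * mtPhi (x / mtSigma d)))) := hc.indicator (hA.preimage hT)
    exact h
  rw [mtGauss, lintegral_smul_measure, setLIntegral_congr_fun measurableSet_Ioi hslice,
    setLIntegral_gaussianReal_Ioi _ hW]
  -- Marsaglia–Tsang's identity turns the integrand into `|T′| · (K y^{a−1} e^{−y} 1_A) ∘ T`
  have hG : ∀ x ∈ Ioi (-mtSigma d),
      ENNReal.ofReal (gaussianPDFReal 0 1 x) *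
        A.indicator (fun _ => ENNReal.ofReal (Real.exp (d * mtPhi (x / mtSigma d)))) (d * mtV d x) =
      ENNReal.ofReal |d * (3 * (1 + x / mtSigma d) ^ 2 * (1 / mtSigma d))| *
        A.indicator (fun y => ENNReal.ofReal (mtK d * (y ^ (d + 1 / 3 - 1) * Real.exp (-y)))) (d * mtV d x) := by
    intro x hx
    have hx' : 0 < 1 + x / mtSigma d := by rw [← setOf_mt_inner hd0] at hx; exact hx
    by_cases hxA : d * mtV d x ∈ A
    · rw [indicator_of_mem hxA, indicator_of_mem hxA,
        ← ENNReal.ofReal_mul (gaussianPDFReal_nonneg _ _ _), mt_pointwise hd0 hx',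
        abs_of_pos (by positivity), ENNReal.ofReal_mul (by positivity)]
    · rw [indicator_of_notMem hxA, indicator_of_notMem hxA, mul_zero, mul_zero]
  rw [setLIntegral_congr_fun measurableSet_Ioi hG, ← lintegral_image_eq_lintegral_abs_deriv_mul measurableSet_Ioi
      (fun x _ => (hasDerivAt_mtT d x).hasDerivWithinAt) (injOn_mtT hd0), image_mtT hd0]
  -- the target integral is `K Γ(a) · Gamma(a,1)(A)`
  have hK : 0 ≤ mtK d := (mtK_pos hd0).le
  have hΓ : 0 < Real.Gamma (d + 1 / 3) := Real.Gamma_pos_of_pos (by linarith)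
  have hind : ∀ y ∈ Ioi (0 : ℝ),
      A.indicator (fun y => ENNReal.ofReal (mtK d * (y ^ (d + 1 / 3 - 1) * Real.exp (-y)))) y =
      ENNReal.ofReal (mtK d * Real.Gamma (d + 1 / 3)) *
        (ENNReal.ofReal (y ^ (d + 1 / 3 - 1) * Real.exp (-y) / Real.Gamma (d + 1 / 3)) * A.indicator 1 y) := by
    intro y _
    by_cases hyA : y ∈ A
    · rw [indicator_of_mem hyA, indicator_of_mem hyA, Pi.one_apply, mul_one,
        ← ENNReal.ofReal_mul (mul_nonneg hK hΓ.le)]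
      congr 1
      field_simp
    · rw [indicator_of_notMem hyA, indicator_of_notMem hyA, mul_zero, mul_zero]
  have hm : Measurable fun y : ℝ =>
      ENNReal.ofReal (y ^ (d + 1 / 3 - 1) * Real.exp (-y) / Real.Gamma (d + 1 / 3)) * A.indicator 1 y :=
    (by fun_prop : Measurable fun y : ℝ =>
      ENNReal.ofReal (y ^ (d + 1 / 3 - 1) * Real.exp (-y) / Real.Gamma (d + 1 / 3))).mul (measurable_one.indicator hA)
  rw [setLIntegral_congr_fun measurableSet_Ioi hind, lintegral_const_mul _ hm,
    ← lintegral_gammaMeasure_one (d + 1 / 3) (measurable_one.indicator hA), lintegral_indicator_one hA,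
    smul_eq_mul, mtAccConst, mul_assoc]

/-- **The accepted part of one round is `C • Gamma(d + 1/3, 1)`.** -/
theorem accPart_mtRound (hd : 7 / 6 ≤ d) : accPart (mtRound d) = mtAccConst d • gammaMeasure (d + 1 / 3) 1 := by
  ext A hA
  rw [accPart_apply hA, Measure.smul_apply, smul_eq_mul, mtRound_apply_prod_true hd hA]

/-- **Cost**: one round accepts with probability `C = (γ(−σ,∞))⁻¹ · K(d) Γ(d + 1/3)`. -/
theorem mtRound_accept (hd : 7 / 6 ≤ d) : mtRound d (univ ×ˢ {true}) = mtAccConst d := by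
  haveI := isProbabilityMeasure_gammaMeasure (a := d + 1 / 3) (r := 1) (by linarith) one_pos
  rw [mtRound_apply_prod_true hd MeasurableSet.univ, measure_univ, mul_one]

/-- **THE MARSAGLIA–TSANG GENERATOR IS EXACT** on the engine's range: for every `d ≥ 7/6` (shape
`a = d + 1/3 ≥ 3/2`), repeating the round until the first acceptance outputs EXACTLY `Gamma(a, 1)`:
`loopLaw (mtRound d) = gammaMeasure (d + 1/3) 1`. -/
theorem loopLaw_mtRound (hd : 7 / 6 ≤ d) : loopLaw (mtRound d) = gammaMeasure (d + 1 / 3) 1 := by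
  have hd0 : 0 < d := by linarith
  rw [loopLaw_eq, mtRound_accept hd, accPart_mtRound hd, smul_smul,
    ENNReal.inv_mul_cancel (mtAccConst_ne_zero hd0) (mtAccConst_ne_top d), one_smul]

/-- … and it halts almost surely. -/
theorem isProbabilityMeasure_loopLaw_mtRound (hd : 7 / 6 ≤ d) : IsProbabilityMeasure (loopLaw (mtRound d)) := by
  rw [loopLaw_mtRound hd]
  exact isProbabilityMeasure_gammaMeasure (by linarith) one_pos

end MT

end Summit.Ventures.LatticeQCDFlow.Exactness
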